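import Summits.BirchSwinnertonDyer.BirchSwinnertonDyer.Theorems.TwinTransportX9HeartReduction
import HarnessLib

/-!
# Skeleton line `parity_split` — crux `TrivialTwinSupplyX9` of route `TwinTransportX9` (item 24080), tribunal-w g7

A SHARPENED alternative to the registered birth skeleton (LINE 3: K2 ⇐ S1 ∧ S2): the analytic supply is split by
the ANALYTIC PARITY of the pair and stripped of every clause the kernel now discharges class-wide
(`frameTransport_classX9`: ClassX9 / Tamagawa / torsion travel along EVERY admissible frame), so that the two
supply stubs are PURE `L`-VALUE statements:

* `stub_unitValueSupplyOddX9` (S1-odd): every X9 pair `(W, p)` with `p ∤ ∏ c_ℓ(W)` and `r_an(W)` ODD has a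
  BCS-admissible frame whose minimal twin `W₁ ≅ W^{(d_K)}` has `r_an(W₁) = 0` and `L(W₁,1)/Ω(W₁) ∈ ℤ_(p)^×`.
  (By the parity law `even_analyticRank_twin_of_odd`, `r_an(W₁)` is automatically EVEN; the content is
  `r_an(W₁) ≠ 2, 4, …` together with the unit value — non-vanishing mod `p` of `L(W^{(d)},1)/Ω` on the admissible
  progression; Prasanna 2010 p. 400, beyond (sur)/(im).) 319 decided instances (rungs #1–#3, slices v1–v3).
* `stub_unitValueSupplyEvenX9` (S1-even): every X9 pair with `p ∤ ∏ c_ℓ(W)` and `r_an(W)` EVEN has TWO admissible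
  steps `W ↦ W₁ ↦ W₂` with `r_an(W₂) = 0` and unit value (the one-step disjunct is EMPTY here:
  `analyticRank_twin_ne_zero_of_even`). Decided instances: `rung2_*`, batches B01–B26.
* `stub_shaUnitOfUnitTwinX9` (S2, verbatim the registered stub): `p ∤ #Ш` at an X9 curve of analytic rank `0` with
  `p ∤ ∏ c_ℓ · #tors` and unit `L`-value (Kolyvagin / Matar–Nekovář (irr)-form; BCS 2025 Cor. 1.3.1 needs (im)).
* `TrivialTwinSupplyX9_of : S1-odd → S1-even → S2 → K2` PROVED (via the landed class-wide reduction
  `trivialTwinSupplyX9_of_unitValueSupply`; no Modularity needed in this direction).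

THE ANALYTIC-RANK HALF OF BOTH SUPPLY STUBS IS CLOSED CLASS-WIDE (modulo Friedberg–Hoffstein + Modularity, binders
`hFH`, `hmod`) by `Theorems/TwinTransportX9AnalyticSupply.lean` (p651743): `oddPair_admissibleTwin_analyticRank_zero`
(at every odd X9 pair with `p ∤ ∏ c_ℓ`: an admissible frame — beyond any bound — whose minimal twin has `r_an = 0`,
`ClassX9`, `p ∤ ∏ c_ℓ`, `p ∤ #tors`) and `evenPair_admissibleTwin₂_analyticRank_zero` (two admissible steps with the
same end). So a prover of `stub_unitValueSupplyOddX9` / `…EvenX9` starts from an INFINITE, CLASS-WIDE NON-EMPTY family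
of admissible analytic-rank-`0` twins and must find ONE with unit value `L/Ω` (non-vanishing mod `p`) — nothing else.

HONEST FRAMING: BSD is not proved; the crux is not proved; sorries = exactly the three stubs. Not registered by
this seat (registration would replace LINE 3's registered birth skeleton that the pen's `--supports` flow matches
against; the LEAD / pen may `ledger skeleton check … --crux stmt-BirchSwinnertonDyer-24080` it if they switch).
-/

set_option linter.dupNamespace false
set_option autoImplicit false

noncomputable section

open scoped Classical

open WeierstrassCurve Summit.BirchSwinnertonDyer.BirchSwinnertonDyer.Rank1Residual
  Summit.BirchSwinnertonDyer.BirchSwinnertonDyer.Theorems.TwinTransportX9Rung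

namespace Summit.BirchSwinnertonDyer.BirchSwinnertonDyer.Cruxes.TrivialTwinSupplyX9.ParitySplit

/-- S1-odd statement: one-step pure unit-value supply at X9 pairs of odd analytic rank. -/
def Stmt.stub_unitValueSupplyOddX9 : Prop :=
  ∀ (W : WeierstrassCurve ℚ) [W.IsElliptic] [W.IsGloballyMinimal] (p : ℕ) [Fact p.Prime],
    ClassX9 W p → ¬ p ∣ W.tamagawaProduct → Odd W.analyticRank →
    ∃ dK dF : ℤ, BCSAdmissiblePair W p dK dF ∧
      ∃ (W₁ : WeierstrassCurve ℚ) (_ : W₁.IsElliptic) (_ : W₁.IsGloballyMinimal),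
        (∃ C : WeierstrassCurve.VariableChange ℚ, C • W₁ = W.quadraticTwist (dK : ℚ)) ∧
        W₁.analyticRank = 0 ∧
        ∃ q : ℚ, W₁.leadingLCoeff / (W₁.realPeriodRat : ℂ) = (q : ℂ) ∧ padicValRat p q = 0

theorem stub_unitValueSupplyOddX9 : Stmt.stub_unitValueSupplyOddX9 := by
  sorry

/-- S1-even statement: two-step pure unit-value supply at X9 pairs of even analytic rank. -/
def Stmt.stub_unitValueSupplyEvenX9 : Prop :=
  ∀ (W : WeierstrassCurve ℚ) [W.IsElliptic] [W.IsGloballyMinimal] (p : ℕ) [Fact p.Prime],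
    ClassX9 W p → ¬ p ∣ W.tamagawaProduct → Even W.analyticRank →
    ∃ dK dF : ℤ, BCSAdmissiblePair W p dK dF ∧
      ∃ (W₁ : WeierstrassCurve ℚ) (_ : W₁.IsElliptic) (_ : W₁.IsGloballyMinimal),
        (∃ C : WeierstrassCurve.VariableChange ℚ, C • W₁ = W.quadraticTwist (dK : ℚ)) ∧
        ∃ dK' dF' : ℤ, BCSAdmissiblePair W₁ p dK' dF' ∧
          ∃ (W₂ : WeierstrassCurve ℚ) (_ : W₂.IsElliptic) (_ : W₂.IsGloballyMinimal),
            (∃ C : WeierstrassCurve.VariableChange ℚ, C • W₂ = W₁.quadraticTwist (dK' : ℚ)) ∧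
            W₂.analyticRank = 0 ∧
            ∃ q : ℚ, W₂.leadingLCoeff / (W₂.realPeriodRat : ℂ) = (q : ℂ) ∧ padicValRat p q = 0

theorem stub_unitValueSupplyEvenX9 : Stmt.stub_unitValueSupplyEvenX9 := by
  sorry

/-- S2 statement (verbatim the registered stub of LINE 3). -/
def Stmt.stub_shaUnitOfUnitTwinX9 : Prop :=
  ∀ (W' : WeierstrassCurve ℚ) [W'.IsElliptic] [W'.IsGloballyMinimal] (p : ℕ) [Fact p.Prime],
    ClassX9 W' p → W'.analyticRank = 0 → ¬ p ∣ W'.tamagawaProduct → ¬ p ∣ W'.torsionOrder →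
    (∃ q : ℚ, W'.leadingLCoeff / (W'.realPeriodRat : ℂ) = (q : ℂ) ∧ padicValRat p q = 0) →
    ¬ p ∣ W'.shaOrder

theorem stub_shaUnitOfUnitTwinX9 : Stmt.stub_shaUnitOfUnitTwinX9 := by
  sorry

/-- **Composition (kernel-checked): K2 ⇐ S1-odd ∧ S1-even ∧ S2**, through the landed class-wide reduction
`trivialTwinSupplyX9_of_unitValueSupply` (Tamagawa / torsion clauses supplied for every frame by
`frameTransport_classX9`). -/
theorem TrivialTwinSupplyX9_of (h1 : Stmt.stub_unitValueSupplyOddX9) (h2 : Stmt.stub_unitValueSupplyEvenX9)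
    (h3 : Stmt.stub_shaUnitOfUnitTwinX9) :
    Summit.BirchSwinnertonDyer.BirchSwinnertonDyer.Theses.TwinTransportX9.TrivialTwinSupplyX9 := by
  refine trivialTwinSupplyX9_of_unitValueSupply (fun W _ _ p _ hX9 hTam => ?_) h3
  rcases Nat.even_or_odd W.analyticRank with he | ho
  · obtain ⟨dK, dF, hadm, W₁, i₁, i₁', hC, dK', dF', hadm', W₂, i₂, i₂', hC', hr, hq⟩ := h2 W p hX9 hTam he
    exact ⟨dK, dF, hadm, W₁, i₁, i₁', hC, Or.inr ⟨dK', dF', hadm', W₂, i₂, i₂', hC', hr, hq⟩⟩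
  · obtain ⟨dK, dF, hadm, W₁, i₁, i₁', hC, hr, hq⟩ := h1 W p hX9 hTam ho
    exact ⟨dK, dF, hadm, W₁, i₁, i₁', hC, Or.inl ⟨hr, hq⟩⟩

end Summit.BirchSwinnertonDyer.BirchSwinnertonDyer.Cruxes.TrivialTwinSupplyX9.ParitySplit

-- short names at top level for the harness skeleton audit
export Summit.BirchSwinnertonDyer.BirchSwinnertonDyer.Cruxes.TrivialTwinSupplyX9.ParitySplit
  (stub_unitValueSupplyOddX9 stub_unitValueSupplyEvenX9 stub_shaUnitOfUnitTwinX9 TrivialTwinSupplyX9_of)
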